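import Summits.ResolutionOfSingularities.ResolutionOfSingularities.Theorems.EquisingularLiftEquisingularLiftNatTowerRoundBTriplePrimeDefs
import Summits.ResolutionOfSingularities.ResolutionOfSingularities.Theorems.EquisingularLiftEquisingularLiftNatTowerRoundBDoublePrimeSDefs
import HarnessLib

/-!
# T23-A‴ «FIBRE PAIRS» (tier T3, engine word v1.2 FINAL d02b1fbd6b6fb5d2, desk R28) — DOWNSTAIRS CHAIN CLOSURES (text owner res-L1-w45b-lead-2 g6):
# (D‴5′) `InCarrierReachKSs` (+ forgetful `inCarrierReachKS_of_inCarrierReachKSs`) / (D‴6) `ReachTowerBTriplePrime` / `ReachNoseTowerBTriplePrime`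

OURS · L1 W4.5(b) · EL♮(3) stmt-ResolutionOfSingularities-20148 (parent EL♮ stmt-…-20038) · counted 0 · AI-written planning vocabulary, weaker than expert review; nothing of
[Hironaka2017] asserted; NOT a statement of the manuscript. Definitions + one pure-logic projection (no `sorry`, no instance, no notation; standard axioms).
`--kind definition --supports stmt-ResolutionOfSingularities-20148 --as helper`. Second of the two A‴ Defs‴ modules (the step predicates `TowerPtRegB₄` / `TowerPtRamB₄` /
`TowerRoundBTriplePrime` are `…NatTowerRoundBTriplePrimeDefs`); the compact residue hypothesis `IsoHypDefTowerBTriplePrime` (= `IsoHypDefTowerBDoublePrimeS` with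
`ReachTowerBDoublePrimeS ↦ ReachTowerBTriplePrime`) follows in `…NatResidueHypDefs3`; rung targets⁗ = the B″S rung targets under that token map and
`ReachNoseTowerBDoublePrime ↦ ReachNoseTowerBTriplePrime`.

PLANE LINEAGE ONLY (desk R28: letters = A⁗). (D‴5′) The in-carrier point phase carries, besides `(T, Z, K)` and the FIRST point plane `S` (transported through every
in-carrier point as today — rule (b): `Z ⊆ S`, the in-carrier section lies inside the plane's model), TWO LISTS: `Ps` = LATER in-carrier planes still MODEL-CARRYING and
`Ms` = MODEL-LESS closed sets; at a point step at `y` the new exceptional plane `υ₁⁻¹{y}` may enter `Ps'` (born WITH its (F1) model), a plane `P ∈ Ps` with `y ∉ P` may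
be transported AWAY into `Ps'` (rule (a), model kept), and the strict transform of ANY member of `Ps ++ Ms` may enter `Ms'` (rule (c′): through the point a later plane
loses its model — res-type-027's flag 2026-08-28T10:44:02Z, stub-4's v1.1 ruling); dropping is always allowed; seeds `S₂ = υ⁻¹{x}`, `Ps₂ = []`, `Ms₂ = []`.
(D‴6) At the carrier round `υ' = Bl_{Z₉}` the tower's model list `Es₁₀` is SEEDED with any sub-family of {`St S₉`} (CO-HOST of the carrier round, the (S-8) block) ∪
{`St P` : `P ∈ Ps₉` crossed by `Z₉` TRANSVERSALLY at every point of `Z₉ ∩ P`, stalkwise (T1) ∧ (T2) — the B′ transversal transport; res-type-027's GUARD adopted by stub-4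
2026-08-28T10:00:51Z: a later plane meets the carrier in finitely many points and the guard fails after a cuspidal in-carrier step}, and `Ns₁₀` with any sub-family of
{`St F` : `F ∈ Ps₉ ++ Ms₉`}; then the round phase is closed under the A‴ steps. ONE disjunct (it subsumes both B″S arms: `Ps`/`Ms` may stay empty); no formal
monotonicity from `ReachTowerBDoublePrimeS` (engine word v1 §1). Upstairs owners (desk DEAL 2026-08-28T10:53:42Z): (U6) in-carrier twins + curve step res-type-027,
closures‴ + V10⁗ stub-4, instance⁗ + rung⁗ stub-2 / lead-2.
-/

set_option linter.dupNamespace false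

noncomputable section

open CategoryTheory CategoryTheory.Limits AlgebraicGeometry TopologicalSpace Topology IsLocalRing
open Literature.AlgebraicGeometry.Resolution
open AlgebraicGeometry.Scheme.IdealSheafData

namespace Summit.ResolutionOfSingularities.ResolutionOfSingularities.Cruxes.EquisingularLiftNat.Sections

/-- **(D‴5′) TOWER / in-carrier point closure carrying the cone shadow `K`, the FIRST point plane `S`, the later MODEL-CARRYING in-carrier planes `Ps` and the
MODEL-LESS list `Ms`** — `InCarrierReachKS` VERBATIM on `(T, Z, K, S, b)` (regular in-carrier point anywhere; one non-regular in-carrier point while the flag is down),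
plus at each step: `Ps'` ⊆ {`υ₁⁻¹{y}`} ∪ {`St P` : `P ∈ Ps`, `y ∉ P`} (rules (F1)/(a)) and `Ms'` ⊆ {`St F` : `F ∈ Ps ++ Ms`} (rule (c′) and model-less transport).
Downstairs only. [OURS · T23-A‴ Defs] -/
def InCarrierReachKSs (F₂ : Scheme.{0}) (T₂ Z₂ K₂ S₂ : Set F₂) (Ps₂ Ms₂ : List (Set F₂)) (F₉ : Scheme.{0}) (β₉ : F₉ ⟶ F₂)
    (T₉ Z₉ K₉ S₉ : Set F₉) (Ps₉ Ms₉ : List (Set F₉)) (b₉ : Bool) : Prop :=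
  ∀ R : (∀ G : Scheme.{0}, (G ⟶ F₂) → Set G → Set G → Set G → Set G → List (Set G) → List (Set G) → Bool → Prop),
    R F₂ (𝟙 F₂) T₂ Z₂ K₂ S₂ Ps₂ Ms₂ false →
    (∀ (G₁ G₂ : Scheme.{0}) (β : G₁ ⟶ F₂) (T Z K S : Set G₁) (Ps Ms : List (Set G₁)) (b : Bool) (y : redSub G₁ (closure Z) isClosed_closure)
        (υ₁ : G₂ ⟶ G₁) (hy : IsClosed ({curvePt G₁ Z y} : Set G₁)) (Ps' Ms' : List (Set G₂)),
      R G₁ β T Z K S Ps Ms b → curvePt G₁ Z y ∈ T →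
      IsRegularLocalRing ((redSub G₁ (closure Z) isClosed_closure).presheaf.stalk y) →
      IsRegularLocalRing (G₁.presheaf.stalk (curvePt G₁ Z y)) →
      IsBlowup υ₁ (Scheme.IdealSheafData.vanishingIdeal (⟨{curvePt G₁ Z y}, hy⟩ : Closeds G₁)) →
      (∀ P' ∈ Ps', P' = υ₁ ⁻¹' {curvePt G₁ Z y} ∨ ∃ P ∈ Ps, curvePt G₁ Z y ∉ P ∧ P' = closure (υ₁ ⁻¹' (P \ {curvePt G₁ Z y}))) →
      (∀ M' ∈ Ms', ∃ F ∈ Ps ++ Ms, M' = closure (υ₁ ⁻¹' (F \ {curvePt G₁ Z y}))) →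
      R G₂ (υ₁ ≫ β) (closure (υ₁ ⁻¹' (T \ {curvePt G₁ Z y}))) (closure (υ₁ ⁻¹' (Z \ {curvePt G₁ Z y})))
        (closure (υ₁ ⁻¹' (K \ {curvePt G₁ Z y}))) (closure (υ₁ ⁻¹' (S \ {curvePt G₁ Z y}))) Ps' Ms' b) →
    (∀ (G₁ G₂ : Scheme.{0}) (β : G₁ ⟶ F₂) (T Z K S : Set G₁) (Ps Ms : List (Set G₁)) (y : redSub G₁ (closure Z) isClosed_closure)
        (υ₁ : G₂ ⟶ G₁) (hy : IsClosed ({curvePt G₁ Z y} : Set G₁)) (Ps' Ms' : List (Set G₂)),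
      R G₁ β T Z K S Ps Ms false → curvePt G₁ Z y ∈ T →
      ¬ IsRegularLocalRing ((redSub G₁ (closure Z) isClosed_closure).presheaf.stalk y) →
      IsRegularLocalRing (G₁.presheaf.stalk (curvePt G₁ Z y)) →
      IsBlowup υ₁ (Scheme.IdealSheafData.vanishingIdeal (⟨{curvePt G₁ Z y}, hy⟩ : Closeds G₁)) →
      (∀ P' ∈ Ps', P' = υ₁ ⁻¹' {curvePt G₁ Z y} ∨ ∃ P ∈ Ps, curvePt G₁ Z y ∉ P ∧ P' = closure (υ₁ ⁻¹' (P \ {curvePt G₁ Z y}))) →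
      (∀ M' ∈ Ms', ∃ F ∈ Ps ++ Ms, M' = closure (υ₁ ⁻¹' (F \ {curvePt G₁ Z y}))) →
      R G₂ (υ₁ ≫ β) (closure (υ₁ ⁻¹' (T \ {curvePt G₁ Z y}))) (closure (υ₁ ⁻¹' (Z \ {curvePt G₁ Z y})))
        (closure (υ₁ ⁻¹' (K \ {curvePt G₁ Z y}))) (closure (υ₁ ⁻¹' (S \ {curvePt G₁ Z y}))) Ps' Ms' true) →
    R F₉ β₉ T₉ Z₉ K₉ S₉ Ps₉ Ms₉ b₉

/-- Forgetting both lists: an `InCarrierReachKSs` chain is an `InCarrierReachKS` chain (pure logic: instantiate the motive ignoring `Ps`/`Ms`; the list menus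
are satisfied by the empty lists) — so every A″-S in-carrier brick stated on `InCarrierReachKS` applies. [OURS · pure logic] -/
theorem inCarrierReachKS_of_inCarrierReachKSs (F₂ : Scheme.{0}) (T₂ Z₂ K₂ S₂ : Set F₂) (Ps₂ Ms₂ : List (Set F₂)) (F₉ : Scheme.{0}) (β₉ : F₉ ⟶ F₂)
    (T₉ Z₉ K₉ S₉ : Set F₉) (Ps₉ Ms₉ : List (Set F₉)) (b₉ : Bool) (h : InCarrierReachKSs F₂ T₂ Z₂ K₂ S₂ Ps₂ Ms₂ F₉ β₉ T₉ Z₉ K₉ S₉ Ps₉ Ms₉ b₉) :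
    InCarrierReachKS F₂ T₂ Z₂ K₂ S₂ F₉ β₉ T₉ Z₉ K₉ S₉ b₉ := by
  intro R hbase hreg hsing
  exact h (fun G β T Z K S _ _ b => R G β T Z K S b) hbase
    (fun G₁ G₂ β T Z K S _ _ b y υ₁ hy _ _ hR hyT h1 h2 h3 _ _ => hreg G₁ G₂ β T Z K S b y υ₁ hy hR hyT h1 h2 h3)
    (fun G₁ G₂ β T Z K S _ _ y υ₁ hy _ _ hR hyT h1 h2 h3 _ _ => hsing G₁ G₂ β T Z K S y υ₁ hy hR hyT h1 h2 h3)

/-- **(D‴6) ReachTowerBTriplePrime** — the B″S S-chain shape with the A‴ steps: VERBATIM prefix (the point `x` on the nose component `W`, principal ideal, cone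
option `K₂`), the in-carrier point phase `InCarrierReachKSs` seeded with the first plane `υ⁻¹{x}` and empty lists, the carrier round `υ' = Bl_{Z₉}`, a CHOSEN round
seed — `Es₁₀` ⊆ {`St S₉`} ∪ {`St P` : `P ∈ Ps₉`, `Z₉` crosses `P` transversally at every point of `Z₉ ∩ P` (stalkwise (T1) ∧ (T2))}, `Ns₁₀` ⊆ {`St F` : `F ∈ Ps₉ ++ Ms₉`} —
and the round phase closed under `TowerPtRegB₄` / `TowerPtRamB₄` / `TowerRoundBTriplePrime` from `R F₁₀ 𝟙 (St T₉) (υ'⁻¹Z₉) Es₁₀ Ns₁₀ (St K₉)`. Downstairs only.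
[OURS · T23-A‴ Defs] -/
def ReachTowerBTriplePrime (F₁ F₂ : Scheme.{0}) (υ : F₂ ⟶ F₁) (x : F₁) (T₂ : Set F₂) (F' : Scheme.{0}) (β : F' ⟶ F₂) (T' : Set F') : Prop :=
  ∃ (W : Set F₁) (K₂ : Set F₂) (F₉ : Scheme.{0}) (β₉ : F₉ ⟶ F₂) (T₉ Z₉ K₉ S₉ : Set F₉) (Ps₉ Ms₉ : List (Set F₉)) (b₉ : Bool) (hZ₉ : IsClosed Z₉)
    (F₁₀ : Scheme.{0}) (υ' : F₁₀ ⟶ F₉) (Es₁₀ Ns₁₀ : List (Set F₁₀)) (γ' : F' ⟶ F₁₀) (E' : Set F') (Es' Ns' : List (Set F')) (K' : Set F'),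
    x ∈ W ∧ ¬ (υ ⁻¹' {x} ⊆ closure (υ ⁻¹' (W \ {x}))) ∧
    (∃ U : F₁.affineOpens, x ∈ (U : F₁.Opens) ∧
      ((Scheme.IdealSheafData.vanishingIdeal (⟨closure W, isClosed_closure⟩ : Closeds F₁)).ideal U).IsPrincipal) ∧
    υ ⁻¹' {x} ∩ closure (υ ⁻¹' (W \ {x})) ⊆ T₂ ∧
    (K₂ = ∅ ∨ (ConeForm F₁ x W ∧ K₂ = closure (υ ⁻¹' (W \ {x})))) ∧
    InCarrierReachKSs F₂ T₂ (υ ⁻¹' {x} ∩ closure (υ ⁻¹' (W \ {x}))) K₂ (υ ⁻¹' {x}) [] [] F₉ β₉ T₉ Z₉ K₉ S₉ Ps₉ Ms₉ b₉ ∧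
    Z₉ ⊆ T₉ ∧ ¬ (T₉ ⊆ Z₉) ∧ Z₉.Infinite ∧
    Set.Finite {z : redSub F₉ Z₉ hZ₉ | ¬ IsRegularLocalRing ((redSub F₉ Z₉ hZ₉).presheaf.stalk z)} ∧
    IsBlowup υ' (Scheme.IdealSheafData.vanishingIdeal (⟨Z₉, hZ₉⟩ : Closeds F₉)) ∧
    (∀ F ∈ Es₁₀, F = closure (υ' ⁻¹' (S₉ \ Z₉)) ∨
      ∃ P ∈ Ps₉, ∃ hP : IsClosed P,
        (∀ g ∈ Z₉ ∩ P, stalkIdeal (vanishingIdeal (⟨Z₉, hZ₉⟩ : Closeds F₉)) g ⊔ stalkIdeal (vanishingIdeal (⟨P, hP⟩ : Closeds F₉)) g =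
            maximalIdeal (F₉.presheaf.stalk g)) ∧
        (∀ g ∈ Z₉ ∩ P, stalkIdeal (vanishingIdeal (⟨Z₉, hZ₉⟩ : Closeds F₉)) g ≠ maximalIdeal (F₉.presheaf.stalk g)) ∧
        F = closure (υ' ⁻¹' (P \ Z₉))) ∧
    (∀ F ∈ Ns₁₀, ∃ P ∈ Ps₉ ++ Ms₉, F = closure (υ' ⁻¹' (P \ Z₉))) ∧
    (∀ R : (∀ G : Scheme.{0}, (G ⟶ F₁₀) → Set G → Set G → List (Set G) → List (Set G) → Set G → Prop),
      R F₁₀ (𝟙 F₁₀) (closure (υ' ⁻¹' (T₉ \ Z₉))) (υ' ⁻¹' Z₉) Es₁₀ Ns₁₀ (closure (υ' ⁻¹' (K₉ \ Z₉))) →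
      TowerPtRegB₄ F₁₀ R → TowerPtRamB₄ F₁₀ R → TowerRoundBTriplePrime F₉ F₁₀ υ' Z₉ hZ₉ R → R F' γ' T' E' Es' Ns' K') ∧
    β = (γ' ≫ υ') ≫ β₉

/-- **(D‴6) ReachNoseTowerBTriplePrime** — `ReachNoseTowerBDoublePrime` with the A‴ steps and lists (seed lists `[]` / `[]`: the nose chain has no point phase,
hence no planes to seed). Downstairs only. [OURS · T23-A‴ Defs] -/
def ReachNoseTowerBTriplePrime (k : Type) [Field k] (n : ℕ) (H : Scheme.{0})
    (ι : H ⟶ (Literature.AlgebraicGeometry.Motives.projectiveSpace n k).left) : Prop :=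
  ∃ (Z : Set (Literature.AlgebraicGeometry.Motives.projectiveSpace n k).left) (hZ : IsClosed Z),
    IsLiftableNoseClass₂ k n Z ∧ Z ⊆ Set.range ι ∧ ¬ (Set.range ι ⊆ Z) ∧ Z.Infinite ∧
    (∀ z : ↥(redSub (Literature.AlgebraicGeometry.Motives.projectiveSpace n k).left Z hZ),
      IsClosed ({z} : Set ↥(redSub (Literature.AlgebraicGeometry.Motives.projectiveSpace n k).left Z hZ)) →
        ringKrullDim ((redSub (Literature.AlgebraicGeometry.Motives.projectiveSpace n k).left Z hZ).presheaf.stalk z) =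
          ((1 : ℕ) : WithBot ℕ∞)) ∧
    ∃ (F₂ : Scheme.{0}) (υ : F₂ ⟶ (Literature.AlgebraicGeometry.Motives.projectiveSpace n k).left),
      IsBlowup υ (Scheme.IdealSheafData.vanishingIdeal
        (⟨Z, hZ⟩ : Closeds (Literature.AlgebraicGeometry.Motives.projectiveSpace n k).left)) ∧
      ∃ (F' : Scheme.{0}) (γ' : F' ⟶ F₂) (T' E' : Set F') (Es' Ns' : List (Set F')) (K' : Set F'),
        (∀ R : (∀ G : Scheme.{0}, (G ⟶ F₂) → Set G → Set G → List (Set G) → List (Set G) → Set G → Prop),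
          R F₂ (𝟙 F₂) (closure (υ ⁻¹' (Set.range ι \ Z))) (υ ⁻¹' Z) [] [] ∅ →
          TowerPtRegB₄ F₂ R →
          TowerPtRamB₄ F₂ R →
          TowerRoundBTriplePrime (Literature.AlgebraicGeometry.Motives.projectiveSpace n k).left F₂ υ Z hZ R →
          R F' γ' T' E' Es' Ns' K') ∧
        Literature.AlgebraicGeometry.Resolution.Scheme.IsRegular (redSub F' (closure T') isClosed_closure)

end Summit.ResolutionOfSingularities.ResolutionOfSingularities.Cruxes.EquisingularLiftNat.Sections

end
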